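import Literature.AlgebraicGeometry.Motives.ProperIntegralPointsFrobeniusTranslate
import Literature.NumberTheory.GaloisRepresentations.AbsIntegersValuationSubringFrobenius
import HarnessLib

/-!
# The Frobenius translate of the reduction of a point of a PROPER scheme (no group structure)
# — [Shimura 1998, §18.6 proof of Thm. 18.6, p. 127 «`(Y^σ)~ = Ỹ^f` for every object `Y` rational over `L`»]

Topic `Literature/AlgebraicGeometry/Motives`; THEOREMS ONLY (no definition, no named fact, no instance, no notation; net
Literature debt 0).  Cell `hodgecm-mathlib` (D-0151), FLOOR-0 programme P5a (D9op, congruence relation for the unitary Shimura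
CURVE), ED4-CUT-LETTER §1 row **C2b-plain**: the `GrpObj`-free twin of the tree's
`reducePointMonoidHom_left_eq_frobenius_comp_of_conj` / `…_of_frobeniusAt` (`ProperIntegralPointsFrobeniusTranslate.lean`, row II-1
E4/Q5, stated for proper GROUP schemes through `reducePointMonoidHom`).  For a proper `O`-scheme `𝒳` WITHOUT group structure the
reduction of an `Ω`-point `P` over the base point `(R, f)` read in a ring `k` along `g : R → k` is the plain composite
`specRingHomι R f g ≫ extendPoint R f 𝒳 P` (valuative criterion, [Hartshorne1977] II.4.7) — the currency of the P5a H-desk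
(`SmoothModelHenselLift`); for `[GrpObj 𝒳]` it is `reducePointMonoidHom R f 𝒳 g P` by `reducePointMonoidHom_apply` (rfl), so
every statement below specialises to the group file.

* §1 (generic) `specRingHomι_comp_extendPoint_naturality₂` — the plain reduction is natural across two base points
  (`extendPoint_naturality₂`); `extendPoint_left_eq_frobenius_comp_of_conj` — valuation rings `V ⊆ L`, `R ⊆ Ω` over `O`,
  `e : L → Ω` with `e(V) ⊆ R`, `s : L → L` with `s(V) ⊆ V` over `φ : O → O`, residue law `e(s z) ≡ e(z)^{pⁿ}` in `κ(R)`: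
  for a proper `O`-scheme `𝒳`, an `L`-point `ξ` over `V` and `Ω`-points `Q` over `(R, f)`, `P′` over the TWISTED base point
  `(R, f ∘ φ)` lying over `Spec e ≫ ξ` and `Spec (e ∘ s) ≫ ξ`: `red(P′) = Spec Frobⁿ_{κ(R)} ≫ red(Q)` on underlying schemes.
* §2 (number field, ALGEBRAIC base point `𝒱 = ℤ̄_𝔓 ⊆ K̄`) `extendPoint_left_eq_frobenius_comp_of_frobeniusAt_absIntegers` — `γ ∈ Aut(K/F₀)`
  with `γ • v = v`, `σ̃ ∈ Aut(K̄)` over `γ` with `σ̃ x ≡ x^q (mod 𝔓)` on `ℤ̄_K` (`q = pⁿ`): for a proper `𝓞ᵥ`-scheme `𝒳` and a `K̄`-point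
  `ξ` over `(𝒱, f′)`, the point `Spec σ̃ ≫ ξ` over the twisted base point `(𝒱, f′ ∘ γᵥ)` reduces to `Spec Frobⁿ_{κ(𝒱)} ≫ red(ξ)`
  (points stay algebraic over `K`; residue law = B-p09's `residue_restrict_absIntegersValuationSubring`).
* §3 (number field, base point `R = 𝒪_{\bar K_v}` along `ι = absClosureEmbedding`) `extendPoint_left_eq_frobenius_comp_of_frobeniusAt` —
  the binders of the group slot :337 VERBATIM minus `[GrpObj 𝒳]`; plumbing = B-p09's public (T1)/(T2) API, no private lemma re-derived.

* §4 (number field) `specRingHomι_comp_extendPoint_specFractionFieldMap` — the plain reduction `𝒳(\bar K_v) → 𝒳(κ̄)` of ANY proper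
  `𝓞ᵥ`-scheme is `Γ_{K_v}`-equivariant in the tree's `residueFieldPoints` action (one base point; `extendPoint_naturality`) — the
  «decomposition-group twist» of the P5a H-row road (b); group version `IsAbelianSchemeModel.reductionHom_smul`.

References: [Shimura1998] §18.6 pp. 127–128; [Hartshorne1977] II.4.7; [NeukirchANT1999] Ch. I §9, Ch. II §8; [SerreTate1968GoodReduction]
§1.  HC_CM is proved only modulo the 7 printed citations until rung 0 closes.
-/

set_option autoImplicit false

-- Compositions through `(specRingHomOver R f g).left = Spec k` are definitional only above `instances` transparency
-- (as in `ProperIntegralPointsTwist` / `ProperIntegralPointsFrobeniusTranslate`).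
set_option backward.isDefEq.respectTransparency false

noncomputable section

open CategoryTheory CategoryTheory.Limits AlgebraicGeometry

universe u

namespace Literature.AlgebraicGeometry.Motives

/-! ### §1. (generic) `red(Spec (e ∘ s) ≫ ξ) = Spec Frobⁿ ≫ red(Spec e ≫ ξ)` for a proper scheme -/

section Generic

variable {O L Ω : Type u} [CommRing O] [Field L] [Field Ω] (V : ValuationSubring L) (R : ValuationSubring Ω)
  (f' : O →+* V) (f : O →+* R) (φ : O →+* O) (e : L →+* Ω) (eV : V →+* R) (s : L →+* L) (sV : V →+* V)
  (p n : ℕ)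

/-- `Spec b ≫ Spec a = Spec c` from `b ∘ a = c`. [folklore] -/
private theorem specMap_comp_specMap_of_comp_eq' {A B C : Type u} [CommRing A] [CommRing B] [CommRing C]
    (a : A →+* B) (b : B →+* C) (c : A →+* C) (h : b.comp a = c) :
    Spec.map (CommRingCat.ofHom b) ≫ Spec.map (CommRingCat.ofHom a) = Spec.map (CommRingCat.ofHom c) := by
  rw [← Spec.map_comp, ← CommRingCat.ofHom_comp, h]

/-- `Spec a ≫ Spec b ≫ Spec c = Spec d ≫ Spec e` from the pointwise identity `a (b (c x)) = d (e x)`. [folklore] -/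
private theorem specMap₃_eq_specMap₂' {X Y Z W U : Type u} [CommRing X] [CommRing Y] [CommRing Z] [CommRing W]
    [CommRing U] (c : X →+* Y) (b : Y →+* Z) (a : Z →+* W) (e' : X →+* U) (d : U →+* W)
    (h : ∀ x, a (b (c x)) = d (e' x)) :
    Spec.map (CommRingCat.ofHom a) ≫ Spec.map (CommRingCat.ofHom b) ≫ Spec.map (CommRingCat.ofHom c) =
      Spec.map (CommRingCat.ofHom d) ≫ Spec.map (CommRingCat.ofHom e') := by
  rw [specMap_comp_specMap_of_comp_eq' c b _ rfl, specMap_comp_specMap_of_comp_eq' _ a _ rfl,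
    specMap_comp_specMap_of_comp_eq' e' d _ rfl]
  congr 2; exact RingHom.ext fun x => h x

/-- `Spec a ≫ Spec b = Spec d ≫ Spec e` from the pointwise identity `a (b x) = d (e x)`. [folklore] -/
private theorem specMap₂_eq_specMap₂' {X Y W U : Type u} [CommRing X] [CommRing Y] [CommRing W] [CommRing U]
    (b : X →+* Y) (a : Y →+* W) (e' : X →+* U) (d : U →+* W) (h : ∀ x, a (b x) = d (e' x)) :
    Spec.map (CommRingCat.ofHom a) ≫ Spec.map (CommRingCat.ofHom b) =
      Spec.map (CommRingCat.ofHom d) ≫ Spec.map (CommRingCat.ofHom e') := by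
  rw [specMap_comp_specMap_of_comp_eq' b a _ rfl, specMap_comp_specMap_of_comp_eq' e' d _ rfl]
  congr 2; exact RingHom.ext fun x => h x

/-- **The plain reduction `Spec k → Spec R → 𝒳` of a point of a proper scheme is natural across two base points**: for an
`O`-morphism `τ : Spec (R₁, f₁) → Spec (R₂, f₂)` between valuation-ring base points with compatible `τ′` on generic points and
`τk` on the special points (`τk ≫ ι₂ = ι₁ ≫ τ`), and an `Ω₂`-point `P` of a proper `O`-scheme `𝒳` (no group structure):
`ι₁ ≫ extend (τ′ ≫ P) = τk ≫ ι₂ ≫ extend P`.  The group version is `reducePointMonoidHom_naturality₂`.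
[cite: Hartshorne1977, II.4.7] -/
theorem specRingHomι_comp_extendPoint_naturality₂ {Ω₁ Ω₂ : Type u} [Field Ω₁] [Field Ω₂] (R₁ : ValuationSubring Ω₁)
    (R₂ : ValuationSubring Ω₂) (f₁ : O →+* R₁) (f₂ : O →+* R₂) (𝒳 : SchemeOver O) [IsProper 𝒳.hom] {k₁ k₂ : Type u}
    [CommRing k₁] [CommRing k₂] (g₁ : R₁ →+* k₁) (g₂ : R₂ →+* k₂)
    (τ : specValuationSubring R₁ f₁ ⟶ specValuationSubring R₂ f₂) (τ' : specFractionField R₁ f₁ ⟶ specFractionField R₂ f₂)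
    (hτ : τ' ≫ specFractionFieldι R₂ f₂ = specFractionFieldι R₁ f₁ ≫ τ)
    (τk : specRingHomOver R₁ f₁ g₁ ⟶ specRingHomOver R₂ f₂ g₂)
    (hk : τk ≫ specRingHomι R₂ f₂ g₂ = specRingHomι R₁ f₁ g₁ ≫ τ) (P : specFractionField R₂ f₂ ⟶ 𝒳) :
    specRingHomι R₁ f₁ g₁ ≫ extendPoint R₁ f₁ 𝒳 (τ' ≫ P) = τk ≫ specRingHomι R₂ f₂ g₂ ≫ extendPoint R₂ f₂ 𝒳 P := by
  rw [extendPoint_naturality₂ R₁ R₂ f₁ f₂ 𝒳 τ τ' hτ P, ← Category.assoc, ← hk, Category.assoc]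

/-- **Equivariance of the plain reduction** (one base point): for compatible endomorphisms `σ` of `R` over `O`, `σΩ` of `Ω` and
`σk` of `k`, `ι_k ≫ extend (Spec σΩ ≫ P) = Spec σk ≫ ι_k ≫ extend P` for a proper `O`-scheme `𝒳` (no group structure).  The
group version is `reducePointMonoidHom_naturality`. [cite: Hartshorne1977, II.4.7] -/
theorem specRingHomι_comp_extendPoint_naturality (𝒳 : SchemeOver O) [IsProper 𝒳.hom] {k : Type u} [CommRing k]
    (g : R →+* k) (σ : R →+* R) (hσ : σ.comp f = f) (σΩ : Ω →+* Ω) (hΩ : σΩ.comp (algebraMap R Ω) = (algebraMap R Ω).comp σ)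
    (σk : k →+* k) (hk : σk.comp g = g.comp σ) (P : specFractionField R f ⟶ 𝒳) :
    specRingHomι R f g ≫ extendPoint R f 𝒳 (specRingHomOverMap (algebraMap R Ω) σ hσ σΩ hΩ ≫ P) =
      specRingHomOverMap g σ hσ σk hk ≫ specRingHomι R f g ≫ extendPoint R f 𝒳 P := by
  rw [extendPoint_naturality R f 𝒳 (specValuationSubringMap σ hσ) _ (specRingHomOverMap_comp_ι (algebraMap R Ω) σ hσ σΩ hΩ),
    ← Category.assoc, ← specRingHomOverMap_comp_ι g σ hσ σk hk, Category.assoc]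

/-- **(C2b-plain) «Frobenius translate at the base point» for a proper scheme, generic form.**  Valuation rings `V ⊆ L`,
`R ⊆ Ω` over `O` (structure maps `f'`, `f`); `e : L → Ω` restricting to `eV : V → R` with `eV ∘ f' = f`; `s : L → L`
restricting to `sV : V → V` over `φ : O → O` (`sV ∘ f' = f' ∘ φ`); residue law `e(s z) ≡ e(z)^{pⁿ}` in `κ(R)`.  Then for a
proper `O`-scheme `𝒳` (NO group structure), an `L`-point `ξ` of `𝒳` over `V`, and `Ω`-points `Q` over `(R, f)`, `P′` over
`(R, f ∘ φ)` lying over `Spec e ≫ ξ` and `Spec (e ∘ s) ≫ ξ`: the plain reductions satisfy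
`red(P′) = Spec Frobⁿ_{κ(R)} ≫ red(Q)` on underlying `κ(R)`-points (uniqueness of extensions over valuation rings, along
`Spec eV` twisted and untwisted and along `Spec sV`).  The group file's §1 is the case `[GrpObj 𝒳]` (`reducePointMonoidHom_apply`).
[cite: Hartshorne1977, II.4.7] [cite: Shimura1998, §18.6 proof of Thm. 18.6, pp. 127–128] -/
theorem extendPoint_left_eq_frobenius_comp_of_conj [ExpChar (IsLocalRing.ResidueField R) p]
    (heV : ∀ z : V, ((eV z : R) : Ω) = e (z : L)) (hef : eV.comp f' = f)
    (hsV : ∀ z : V, ((sV z : V) : L) = s (z : L)) (hsf : sV.comp f' = f'.comp φ)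
    (hres : ∀ z : V, IsLocalRing.residue R (eV (sV z)) = (IsLocalRing.residue R (eV z)) ^ p ^ n)
    (𝒳 : SchemeOver O) [IsProper 𝒳.hom] (ξ : specFractionField V f' ⟶ 𝒳)
    (Q : specFractionField R f ⟶ 𝒳) (P' : specFractionField R (f.comp φ) ⟶ 𝒳)
    (hQ : Q.left = Spec.map (CommRingCat.ofHom e) ≫ ξ.left)
    (hP' : P'.left = Spec.map (CommRingCat.ofHom (e.comp s)) ≫ ξ.left) :
    (specRingHomι R (f.comp φ) (IsLocalRing.residue R) ≫ extendPoint R (f.comp φ) 𝒳 P').left =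
      Spec.map (CommRingCat.ofHom (iterateFrobenius (IsLocalRing.ResidueField R) p n)) ≫
        (specRingHomι R f (IsLocalRing.residue R) ≫ extendPoint R f 𝒳 Q).left := by
  -- the `κ(R)`-valued residue map of `V` along `e`
  let gV : V →+* IsLocalRing.ResidueField R := (IsLocalRing.residue R).comp eV
  -- pointwise identities (`algebraMap ↥V L z` is `↑z` definitionally)
  have heV' : ∀ z : V, algebraMap R Ω (eV z) = e (algebraMap V L z) := heV
  have hsV' : ∀ z : V, algebraMap V L (sV z) = s (algebraMap V L z) := hsV
  have pf : ∀ x, eV (f' x) = f x := fun x => RingHom.congr_fun hef x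
  have ps : ∀ x, sV (f' x) = f' (φ x) := fun x => RingHom.congr_fun hsf x
  have pF : ∀ z : V, gV (sV z) = iterateFrobenius _ p n (gV z) := fun z => by
    change IsLocalRing.residue R (eV (sV z)) = iterateFrobenius _ p n (IsLocalRing.residue R (eV z))
    rw [iterateFrobenius_def, hres z]
  -- (1) along `Spec eV : Spec (R, f) → Spec (V, f')`
  let τ₁ : specValuationSubring R f ⟶ specValuationSubring V f' :=
    Over.homMk (Spec.map (CommRingCat.ofHom eV)) (specMap_comp_specMap_of_comp_eq' f' eV f hef)
  let τ₁' : specFractionField R f ⟶ specFractionField V f' :=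
    Over.homMk (Spec.map (CommRingCat.ofHom e)) (specMap₃_eq_specMap₂' f' (algebraMap V L) e f (algebraMap R Ω)
      fun x => by rw [← pf, heV'])
  have hτ₁ : τ₁' ≫ specFractionFieldι V f' = specFractionFieldι R f ≫ τ₁ :=
    Over.OverMorphism.ext (specMap₂_eq_specMap₂' (algebraMap V L) e eV (algebraMap R Ω) fun z => (heV' z).symm)
  let τk₁ : specRingHomOver R f (IsLocalRing.residue R) ⟶ specRingHomOver V f' gV :=
    Over.homMk (𝟙 _) (by
      rw [Category.id_comp]
      exact specMap₂_eq_specMap₂' f' gV f _ fun x => by change IsLocalRing.residue R (eV (f' x)) = _; rw [pf])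
  have hk₁ : τk₁ ≫ specRingHomι V f' gV = specRingHomι R f (IsLocalRing.residue R) ≫ τ₁ :=
    Over.OverMorphism.ext (by
      change 𝟙 _ ≫ Spec.map _ = Spec.map _ ≫ Spec.map _
      rw [Category.id_comp, specMap_comp_specMap_of_comp_eq' eV _ _ rfl])
  have hQ' : Q = τ₁' ≫ ξ := Over.OverMorphism.ext (by rw [hQ]; rfl)
  have e1 : (specRingHomι R f (IsLocalRing.residue R) ≫ extendPoint R f 𝒳 Q).left =
      (specRingHomι V f' gV ≫ extendPoint V f' 𝒳 ξ).left := by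
    rw [hQ', specRingHomι_comp_extendPoint_naturality₂ R V f f' 𝒳 (IsLocalRing.residue R) gV τ₁ τ₁' hτ₁ τk₁ hk₁ ξ,
      Over.comp_left]
    exact Category.id_comp _
  -- (2) along `Spec sV : Spec (V, f' ∘ φ) → Spec (V, f')`
  let τ₂ : specValuationSubring V (f'.comp φ) ⟶ specValuationSubring V f' :=
    Over.homMk (Spec.map (CommRingCat.ofHom sV)) (specMap_comp_specMap_eq_of_comp_eq f' f' φ sV hsf)
  let τ₂' : specFractionField V (f'.comp φ) ⟶ specFractionField V f' :=
    Over.homMk (Spec.map (CommRingCat.ofHom s)) (specMap₃_eq_specMap₂' f' (algebraMap V L) s (f'.comp φ) (algebraMap V L)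
      fun x => by rw [← hsV', ps, RingHom.comp_apply])
  have hτ₂ : τ₂' ≫ specFractionFieldι V f' = specFractionFieldι V (f'.comp φ) ≫ τ₂ :=
    Over.OverMorphism.ext (specMap₂_eq_specMap₂' (algebraMap V L) s sV (algebraMap V L) fun z => (hsV' z).symm)
  let τk₂ : specRingHomOver V (f'.comp φ) gV ⟶ specRingHomOver V f' gV :=
    Over.homMk (Spec.map (CommRingCat.ofHom (iterateFrobenius (IsLocalRing.ResidueField R) p n)))
      (specMap₃_eq_specMap₂' f' gV (iterateFrobenius _ p n) (f'.comp φ) gV fun x => by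
        change iterateFrobenius _ p n (gV (f' x)) = gV (f' (φ x)); rw [← ps, pF])
  have hk₂ : τk₂ ≫ specRingHomι V f' gV = specRingHomι V (f'.comp φ) gV ≫ τ₂ :=
    Over.OverMorphism.ext (specMap₂_eq_specMap₂' gV (iterateFrobenius _ p n) sV gV fun z => (pF z).symm)
  have e2 : (specRingHomι V (f'.comp φ) gV ≫ extendPoint V (f'.comp φ) 𝒳 (τ₂' ≫ ξ)).left =
      Spec.map (CommRingCat.ofHom (iterateFrobenius (IsLocalRing.ResidueField R) p n)) ≫
        (specRingHomι V f' gV ≫ extendPoint V f' 𝒳 ξ).left := by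
    rw [specRingHomι_comp_extendPoint_naturality₂ V V (f'.comp φ) f' 𝒳 gV gV τ₂ τ₂' hτ₂ τk₂ hk₂ ξ, Over.comp_left]; rfl
  -- (3) along `Spec eV : Spec (R, f ∘ φ) → Spec (V, f' ∘ φ)` (twisted base points)
  let τ₃ : specValuationSubring R (f.comp φ) ⟶ specValuationSubring V (f'.comp φ) :=
    Over.homMk (Spec.map (CommRingCat.ofHom eV))
      (specMap_comp_specMap_of_comp_eq' (f'.comp φ) eV (f.comp φ) (by rw [← RingHom.comp_assoc, hef]))
  let τ₃' : specFractionField R (f.comp φ) ⟶ specFractionField V (f'.comp φ) :=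
    Over.homMk (Spec.map (CommRingCat.ofHom e)) (specMap₃_eq_specMap₂' (f'.comp φ) (algebraMap V L) e (f.comp φ)
      (algebraMap R Ω) fun x => by rw [RingHom.comp_apply, RingHom.comp_apply, ← pf, heV'])
  have hτ₃ : τ₃' ≫ specFractionFieldι V (f'.comp φ) = specFractionFieldι R (f.comp φ) ≫ τ₃ :=
    Over.OverMorphism.ext (specMap₂_eq_specMap₂' (algebraMap V L) e eV (algebraMap R Ω) fun z => (heV' z).symm)
  let τk₃ : specRingHomOver R (f.comp φ) (IsLocalRing.residue R) ⟶ specRingHomOver V (f'.comp φ) gV :=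
    Over.homMk (𝟙 _) (by
      rw [Category.id_comp]
      exact specMap₂_eq_specMap₂' (f'.comp φ) gV (f.comp φ) _ fun x => by
        change IsLocalRing.residue R (eV (f' (φ x))) = IsLocalRing.residue R (f (φ x)); rw [pf])
  have hk₃ : τk₃ ≫ specRingHomι V (f'.comp φ) gV = specRingHomι R (f.comp φ) (IsLocalRing.residue R) ≫ τ₃ :=
    Over.OverMorphism.ext (by
      change 𝟙 _ ≫ Spec.map _ = Spec.map _ ≫ Spec.map _
      rw [Category.id_comp, specMap_comp_specMap_of_comp_eq' eV _ _ rfl])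
  have hP'' : P' = τ₃' ≫ τ₂' ≫ ξ := Over.OverMorphism.ext (by
    rw [hP', Over.comp_left, Over.comp_left, CommRingCat.ofHom_comp, Spec.map_comp, Category.assoc]; rfl)
  have e3 : (specRingHomι R (f.comp φ) (IsLocalRing.residue R) ≫ extendPoint R (f.comp φ) 𝒳 P').left =
      (specRingHomι V (f'.comp φ) gV ≫ extendPoint V (f'.comp φ) 𝒳 (τ₂' ≫ ξ)).left := by
    rw [hP'', specRingHomι_comp_extendPoint_naturality₂ R V (f.comp φ) (f'.comp φ) 𝒳 (IsLocalRing.residue R) gV τ₃ τ₃'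
      hτ₃ τk₃ hk₃ (τ₂' ≫ ξ), Over.comp_left]
    exact Category.id_comp _
  rw [e3, e2, e1]

end Generic

/-! ### §2. (number field) The ALGEBRAIC base point `𝒱 = ℤ̄_{𝔓₀} ⊆ K̄` -/

section NumberField

open NumberField IsDedekindDomain IsDedekindDomain.HeightOneSpectrum IsLocalRing Field
open scoped Valued Pointwise
open Literature.NumberTheory.GaloisRepresentations Literature.NumberTheory.DiophantineGeometry

variable {K : Type} [Field K] [NumberField K] (v : HeightOneSpectrum (𝓞 K))

/-- **(C2b-plain, algebraic base point) «`(Y^σ)~ = Ỹ^f`» for a proper `𝓞ᵥ`-scheme, over `𝒱 = ℤ̄_{𝔓₀}`.**  For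
`γ ∈ Aut(K/F₀)` with `γ • v = v` (`γᵥ = algEquivValuationSubring v γ _` the induced automorphism of `𝓞ᵥ`), `σ̃ ∈ Aut(K̄)` over
`γ` with `σ̃ x ≡ x^q (mod 𝔓₀)` on `ℤ̄_K` (`q = pⁿ`, `p` the residue characteristic of `𝒱 = absIntegersValuationSubring 𝔓₀`),
a ring map `f′ : 𝓞ᵥ → 𝒱` with underlying map `𝓞ᵥ ⊆ K ⊆ K̄`, a proper `𝓞ᵥ`-scheme `𝒳` (NO group structure), a `K̄`-point
`ξ` of `𝒳` over `(𝒱, f′)` and the `K̄`-point `P′` over the TWISTED base point `(𝒱, f′ ∘ γᵥ)` lying over `Spec σ̃ ≫ ξ`: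
`red(P′) = Spec Frobⁿ_{κ(𝒱)} ≫ red(ξ)` on underlying schemes (`red` = `Spec κ(𝒱) → Spec 𝒱 →` the unique extension).  The
generic §1 at `V = R = 𝒱`, `e = id`, `s = σ̃`; the residue law is `residue_restrict_absIntegersValuationSubring`.
[cite: Shimura1998, §18.6 proof of Thm. 18.6, pp. 127–128] [cite: NeukirchANT1999, Ch. I §9 Prop. (9.4)] [cite: Hartshorne1977, II.4.7] -/
theorem extendPoint_left_eq_frobenius_comp_of_frobeniusAt_absIntegers (𝔓 : Ideal (absIntegers (𝓞 K) K)) [𝔓.IsMaximal]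
    {F₀ : Type} [Field F₀] [Algebra F₀ K] (γ : K ≃ₐ[F₀] K) (hγv : γ • v.asIdeal = v.asIdeal) (p n : ℕ)
    [ExpChar (ResidueField (absIntegersValuationSubring 𝔓)) p] (q : ℕ) (hq : q = p ^ n)
    (σt : AlgebraicClosure K ≃+* AlgebraicClosure K)
    (hσa : ∀ a : K, σt (algebraMap K (AlgebraicClosure K) a) = algebraMap K (AlgebraicClosure K) (γ.toRingEquiv a))
    (hσ𝔓 : ∀ x : absIntegers (𝓞 K) K, ∃ hx : σt x ∈ absIntegers (𝓞 K) K,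
      (⟨σt x, hx⟩ : absIntegers (𝓞 K) K) - x ^ q ∈ 𝔓)
    (f' : valuationSubringAtPrime K v →+* absIntegersValuationSubring 𝔓)
    (hf' : ∀ x : valuationSubringAtPrime K v,
      ((f' x : absIntegersValuationSubring 𝔓) : AlgebraicClosure K) = algebraMap K (AlgebraicClosure K) (x : K))
    (𝒳 : SchemeOver (valuationSubringAtPrime K v)) [IsProper 𝒳.hom]
    (ξ : specFractionField (absIntegersValuationSubring 𝔓) f' ⟶ 𝒳)
    (P' : specFractionField (absIntegersValuationSubring 𝔓) (f'.comp (algEquivValuationSubring v γ hγv).toRingHom) ⟶ 𝒳)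
    (hP' : P'.left = Spec.map (CommRingCat.ofHom σt.toRingHom) ≫ ξ.left) :
    (specRingHomι (absIntegersValuationSubring 𝔓) (f'.comp (algEquivValuationSubring v γ hγv).toRingHom)
          (residue (absIntegersValuationSubring 𝔓)) ≫
        extendPoint (absIntegersValuationSubring 𝔓) (f'.comp (algEquivValuationSubring v γ hγv).toRingHom) 𝒳 P').left =
      Spec.map (CommRingCat.ofHom (iterateFrobenius (ResidueField (absIntegersValuationSubring 𝔓)) p n)) ≫
        (specRingHomι (absIntegersValuationSubring 𝔓) f' (residue (absIntegersValuationSubring 𝔓)) ≫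
          extendPoint (absIntegersValuationSubring 𝔓) f' 𝒳 ξ).left := by
  subst hq
  have hq1 : 1 ≤ p ^ n := Nat.one_le_pow _ _ (expChar_pos (ResidueField (absIntegersValuationSubring 𝔓)) p)
  -- `σ̃|_{ℤ̄_𝔓} : ℤ̄_𝔓 → ℤ̄_𝔓` (B-p09's (T2) API)
  let sV : absIntegersValuationSubring 𝔓 →+* absIntegersValuationSubring 𝔓 :=
    σt.toRingHom.restrict (absIntegersValuationSubring 𝔓) (absIntegersValuationSubring 𝔓)
      (forall_apply_mem_absIntegersValuationSubring 𝔓 σt (p ^ n) hσ𝔓 hq1)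
  have hsV : ∀ z : absIntegersValuationSubring 𝔓,
      ((sV z : absIntegersValuationSubring 𝔓) : AlgebraicClosure K) = σt.toRingHom (z : AlgebraicClosure K) := fun _ => rfl
  have hsf : sV.comp f' = f'.comp (algEquivValuationSubring v γ hγv).toRingHom := by
    refine RingHom.ext fun x => Subtype.ext ?_
    change σt ((f' x : absIntegersValuationSubring 𝔓) : AlgebraicClosure K) =
      ((f' (algEquivValuationSubring v γ hγv x) : absIntegersValuationSubring 𝔓) : AlgebraicClosure K)
    rw [hf', hf', coe_algEquivValuationSubring, hσa]
    rfl
  have hres : ∀ z : absIntegersValuationSubring 𝔓,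
      residue (absIntegersValuationSubring 𝔓) ((RingHom.id _) (sV z)) =
        residue (absIntegersValuationSubring 𝔓) ((RingHom.id _) z) ^ p ^ n := fun z =>
    residue_restrict_absIntegersValuationSubring 𝔓 σt (p ^ n) hσ𝔓 hq1 z
  have hξ : ξ.left = Spec.map (CommRingCat.ofHom (RingHom.id (AlgebraicClosure K))) ≫ ξ.left := by
    rw [CommRingCat.ofHom_id, Spec.map_id, Category.id_comp]
  exact extendPoint_left_eq_frobenius_comp_of_conj (absIntegersValuationSubring 𝔓) (absIntegersValuationSubring 𝔓) f' f'
    (algEquivValuationSubring v γ hγv).toRingHom (RingHom.id _) (RingHom.id _) σt.toRingHom sV p n (fun _ => rfl)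
    (RingHom.id_comp _) hsV hsf hres 𝒳 ξ ξ P' hξ hP'

/-! ### §3. (number field) The base point `R = 𝒪_{\bar K_v}` along the chosen embedding `ι : K̄ → \bar K_v` -/

/-- **(C2b-plain) «Frobenius translate at the base point» for a proper `𝓞ᵥ`-scheme** ([Shimura1998] proof of Thm. 18.6, p. 127
«`(Y^σ)~ = Ỹ^f` for every object `Y` rational over `L`»; [SerreTate1968GoodReduction] §1): for `γ ∈ Aut(K/F₀)` with `γ • v = v` (`γᵥ` the induced
automorphism of `𝓞ᵥ`), `σ̃ ∈ Aut(K̄)` over `γ` with `σ̃ x ≡ x^q (mod 𝔓₀)` on `ℤ̄_K` (`q = pⁿ`, `𝔓₀` the prime of the chosen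
`ι : K̄ → \bar{K_v}`), any structure map `f′ : 𝓞ᵥ → ℤ̄_{𝔓₀}` with underlying map `𝓞ᵥ ⊆ K ⊆ K̄`, a proper `𝓞ᵥ`-scheme `𝒳` (NO
group structure), a `K̄`-point `ξ` of `𝒳` over `ℤ̄_{𝔓₀}`, the `\bar{K_v}`-point `Q` over `(R, f)` lying over `Spec ι ≫ ξ` and the
`\bar{K_v}`-point `P′` over the TWISTED base point `(R, f ∘ γᵥ)` lying over `Spec (ι ∘ σ̃) ≫ ξ`:
`red(P′) = Spec Frobⁿ_{κ(R)} ≫ red(Q)`.  Same binders as the group slot `reducePointMonoidHom_left_eq_frobenius_comp_of_frobeniusAt`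
minus `[GrpObj 𝒳]`; plumbing from `AbsIntegersValuationSubringFrobenius` (`ι(ℤ̄_{𝔓₀}) ⊆ R` local, `σ̃ ℤ̄_{𝔓₀} ⊆ ℤ̄_{𝔓₀}`, residue law).
[cite: Shimura1998, §18.6 proof of Thm. 18.6, pp. 127–128] [cite: NeukirchANT1999, Ch. II §8 (8.1)] [cite: Hartshorne1977, II.4.7] -/
theorem extendPoint_left_eq_frobenius_comp_of_frobeniusAt [(adicCompletionPrime K v).IsMaximal]
    {F₀ : Type} [Field F₀] [Algebra F₀ K] (γ : K ≃ₐ[F₀] K) (hγv : γ • v.asIdeal = v.asIdeal) (p n : ℕ)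
    [ExpChar (ResidueField (closureValuationSubring (v.adicCompletion K))) p] (q : ℕ) (hq : q = p ^ n)
    (σt : AlgebraicClosure K ≃+* AlgebraicClosure K)
    (hσa : ∀ a : K, σt (algebraMap K (AlgebraicClosure K) a) = algebraMap K (AlgebraicClosure K) (γ.toRingEquiv a))
    (hσ𝔓 : ∀ x : absIntegers (𝓞 K) K, ∃ hx : σt x ∈ absIntegers (𝓞 K) K,
      (⟨σt x, hx⟩ : absIntegers (𝓞 K) K) - x ^ q ∈ adicCompletionPrime K v)
    (f' : valuationSubringAtPrime K v →+* absIntegersValuationSubring (adicCompletionPrime K v))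
    (hf' : ∀ x : valuationSubringAtPrime K v,
      ((f' x : absIntegersValuationSubring (adicCompletionPrime K v)) : AlgebraicClosure K) =
        algebraMap K (AlgebraicClosure K) (x : K))
    (𝒳 : SchemeOver (valuationSubringAtPrime K v)) [IsProper 𝒳.hom]
    (ξ : specFractionField (absIntegersValuationSubring (adicCompletionPrime K v)) f' ⟶ 𝒳)
    (Q : specFractionField (closureValuationSubring (v.adicCompletion K)) (toClosureValuationSubring v) ⟶ 𝒳)
    (P' : specFractionField (closureValuationSubring (v.adicCompletion K))
      ((toClosureValuationSubring v).comp (algEquivValuationSubring v γ hγv).toRingHom) ⟶ 𝒳)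
    (hQ : Q.left = Spec.map (CommRingCat.ofHom (absClosureEmbedding K (v.adicCompletion K)).toRingHom) ≫ ξ.left)
    (hP' : P'.left = Spec.map (CommRingCat.ofHom
      ((absClosureEmbedding K (v.adicCompletion K)).toRingHom.comp σt.toRingHom)) ≫ ξ.left) :
    (specRingHomι (closureValuationSubring (v.adicCompletion K))
          ((toClosureValuationSubring v).comp (algEquivValuationSubring v γ hγv).toRingHom)
          (residue (closureValuationSubring (v.adicCompletion K))) ≫
        extendPoint (closureValuationSubring (v.adicCompletion K))
          ((toClosureValuationSubring v).comp (algEquivValuationSubring v γ hγv).toRingHom) 𝒳 P').left =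
      Spec.map (CommRingCat.ofHom (iterateFrobenius (ResidueField (closureValuationSubring (v.adicCompletion K))) p n)) ≫
        (specRingHomι (closureValuationSubring (v.adicCompletion K)) (toClosureValuationSubring v)
            (residue (closureValuationSubring (v.adicCompletion K))) ≫
          extendPoint (closureValuationSubring (v.adicCompletion K)) (toClosureValuationSubring v) 𝒳 Q).left := by
  subst hq
  have hq1 : 1 ≤ p ^ n :=
    Nat.one_le_pow _ _ (expChar_pos (ResidueField (closureValuationSubring (v.adicCompletion K))) p)
  -- the restrictions `ι|_{ℤ̄_𝔓} : ℤ̄_𝔓 → R` (T1) and `σ̃|_{ℤ̄_𝔓} : ℤ̄_𝔓 → ℤ̄_𝔓` (T2), B-p09's public API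
  let eV : absIntegersValuationSubring (adicCompletionPrime K v) →+* closureValuationSubring (v.adicCompletion K) :=
    (absClosureEmbedding K (v.adicCompletion K)).toRingHom.restrict
      (absIntegersValuationSubring (adicCompletionPrime K v)) (closureValuationSubring (v.adicCompletion K))
      (forall_absClosureEmbedding_mem_closureValuationSubring_adicCompletion K v)
  let sV : absIntegersValuationSubring (adicCompletionPrime K v) →+* absIntegersValuationSubring (adicCompletionPrime K v) :=
    σt.toRingHom.restrict (absIntegersValuationSubring (adicCompletionPrime K v))
      (absIntegersValuationSubring (adicCompletionPrime K v))
      (forall_apply_mem_absIntegersValuationSubring (adicCompletionPrime K v) σt (p ^ n) hσ𝔓 hq1)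
  have heV : ∀ z : absIntegersValuationSubring (adicCompletionPrime K v),
      ((eV z : closureValuationSubring (v.adicCompletion K)) : AlgebraicClosure (v.adicCompletion K)) =
        (absClosureEmbedding K (v.adicCompletion K)).toRingHom (z : AlgebraicClosure K) := fun _ => rfl
  have hef : eV.comp f' = toClosureValuationSubring v := by
    refine RingHom.ext fun x => Subtype.ext ?_
    change absClosureEmbedding K (v.adicCompletion K)
      ((f' x : absIntegersValuationSubring (adicCompletionPrime K v)) : AlgebraicClosure K) = _
    rw [hf', absClosureEmbedding_algebraMap_valuationSubringAtPrime]
  have hsV : ∀ z : absIntegersValuationSubring (adicCompletionPrime K v),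
      ((sV z : absIntegersValuationSubring (adicCompletionPrime K v)) : AlgebraicClosure K) =
        σt.toRingHom (z : AlgebraicClosure K) := fun _ => rfl
  have hsf : sV.comp f' = f'.comp (algEquivValuationSubring v γ hγv).toRingHom := by
    refine RingHom.ext fun x => Subtype.ext ?_
    change σt ((f' x : absIntegersValuationSubring (adicCompletionPrime K v)) : AlgebraicClosure K) =
      ((f' (algEquivValuationSubring v γ hγv x) : absIntegersValuationSubring (adicCompletionPrime K v)) :
        AlgebraicClosure K)
    rw [hf', hf', coe_algEquivValuationSubring, hσa]
    rfl
  haveI : IsLocalHom eV := isLocalHom_restrict_absClosureEmbedding_adicCompletion K v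
  -- residue law in `κ(R)`: push B-p09's residue law in `κ(ℤ̄_𝔓)` along the local homomorphism `ι|`
  have hres : ∀ z : absIntegersValuationSubring (adicCompletionPrime K v),
      residue (closureValuationSubring (v.adicCompletion K)) (eV (sV z)) =
        residue (closureValuationSubring (v.adicCompletion K)) (eV z) ^ p ^ n := fun z => by
    have h1 := congrArg (ResidueField.map eV)
      (residue_restrict_absIntegersValuationSubring (adicCompletionPrime K v) σt (p ^ n) hσ𝔓 hq1 z)
    rw [map_pow, ResidueField.map_residue, ResidueField.map_residue] at h1
    exact h1
  exact extendPoint_left_eq_frobenius_comp_of_conj (absIntegersValuationSubring (adicCompletionPrime K v))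
    (closureValuationSubring (v.adicCompletion K)) f' (toClosureValuationSubring v)
    (algEquivValuationSubring v γ hγv).toRingHom (absClosureEmbedding K (v.adicCompletion K)).toRingHom eV
    σt.toRingHom sV p n heV hef hsV hsf hres 𝒳 ξ Q P' hQ hP'

/-! ### §4. (number field) The plain reduction of `\bar K_v`-points of a proper `𝓞ᵥ`-scheme is `Γ_{K_v}`-equivariant -/

/-- **The plain reduction map `𝒳(\bar K_v) → 𝒳(κ̄)` of a proper `𝓞ᵥ`-scheme is `Γ_{K_v}`-equivariant** (no group structure):
for `σ ∈ Γ_{K_v}` and a `\bar K_v`-point `Q` over `(R, 𝓞ᵥ → R)`, `red(Spec σ ≫ Q) = σ • red(Q)` in the tree's `residueFieldPoints 𝒳`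
(`σ • P = Spec σ̄ ≫ P`, `AbelianSchemeModelReduction`); with ★ `residueFieldMap_apply_eq_pow_of_isAbsArithFrob` this is the Frobenius
case over the untwisted base point, and it is the «decomposition-group twist» step of the P5a H-row road (b).  The group version is
`IsAbelianSchemeModel.reductionHom_smul`. [cite: SerreTate1968GoodReduction, §1 Lemma 2] [cite: Hartshorne1977, II.4.7] -/
theorem specRingHomι_comp_extendPoint_specFractionFieldMap (𝒳 : SchemeOver (valuationSubringAtPrime K v)) [IsProper 𝒳.hom]
    (σ : absoluteGaloisGroup (v.adicCompletion K))
    (Q : specFractionField (closureValuationSubring (v.adicCompletion K)) (toClosureValuationSubring v) ⟶ 𝒳) :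
    specRingHomι (closureValuationSubring (v.adicCompletion K)) (toClosureValuationSubring v)
          (residue (closureValuationSubring (v.adicCompletion K))) ≫
        extendPoint (closureValuationSubring (v.adicCompletion K)) (toClosureValuationSubring v) 𝒳
          (specFractionFieldMap v σ ≫ Q) =
      σ • (specRingHomι (closureValuationSubring (v.adicCompletion K)) (toClosureValuationSubring v)
          (residue (closureValuationSubring (v.adicCompletion K))) ≫
        extendPoint (closureValuationSubring (v.adicCompletion K)) (toClosureValuationSubring v) 𝒳 Q) := by
  rw [residueFieldPoints.smul_def]
  exact specRingHomι_comp_extendPoint_naturality (closureValuationSubring (v.adicCompletion K)) (toClosureValuationSubring v) 𝒳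
    (residue _) (closureValuationSubringMap σ) (closureValuationSubringMap_comp_toClosureValuationSubring v σ)
    (absoluteGaloisGroup.toAlgEquiv (v.adicCompletion K) σ).toAlgHom.toRingHom (algebraMap_comp_closureValuationSubringMap σ)
    (residueFieldMap σ) (residueFieldMap_comp_residue σ) Q

/-- The same on underlying schemes: `(red(Spec σ ≫ Q)).left = Spec σ̄ ≫ (red Q).left`. [cite: SerreTate1968GoodReduction, §1 Lemma 2] -/
theorem extendPoint_left_specFractionFieldMap (𝒳 : SchemeOver (valuationSubringAtPrime K v)) [IsProper 𝒳.hom]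
    (σ : absoluteGaloisGroup (v.adicCompletion K))
    (Q : specFractionField (closureValuationSubring (v.adicCompletion K)) (toClosureValuationSubring v) ⟶ 𝒳) :
    (specRingHomι (closureValuationSubring (v.adicCompletion K)) (toClosureValuationSubring v)
          (residue (closureValuationSubring (v.adicCompletion K))) ≫
        extendPoint (closureValuationSubring (v.adicCompletion K)) (toClosureValuationSubring v) 𝒳
          (specFractionFieldMap v σ ≫ Q)).left =
      Spec.map (CommRingCat.ofHom (residueFieldMap σ)) ≫
        (specRingHomι (closureValuationSubring (v.adicCompletion K)) (toClosureValuationSubring v)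
            (residue (closureValuationSubring (v.adicCompletion K))) ≫
          extendPoint (closureValuationSubring (v.adicCompletion K)) (toClosureValuationSubring v) 𝒳 Q).left := by
  rw [specRingHomι_comp_extendPoint_specFractionFieldMap, residueFieldPoints.smul_def, Over.comp_left]; rfl

end NumberField

end Literature.AlgebraicGeometry.Motives

end
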